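import Summits.CriticalPhenomena.PercolationContinuityZ3.Theorems.PercNearOneGluingNoHeavyPcintMemoryFourFisherSykes
import HarnessLib

/-!
# CriticalPhenomena/PercolationContinuityZ3 — Theorems/PercNearOneGluingNoHeavyPcintLoopExclusionBondRungFour.lean: the first rung of the BOND window `0 < R_4(d) < 1` completed for the lane's dimensions `d = 2, …, 6`

Lane prim-pcint, STRUCTURE rule; companion of …PcintLoopExclusionFirstRungs (`R_4(d) > 0` for all `d ≥ 2`) and
…PcintMemoryFourFisherSykes (`μ_4(d)` is the Fisher–Sykes root; in particular `θ ≤ μ_4(d)` for every `θ > 1` with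
`f(θ) = θ³ − 2(d−1)θ² − 2(d−1)θ − 1 ≤ 0`).  The upper inequality `R_4(d) < 1` of clause (a) of the typed law C4
(`loopCompatWindow`) at the first rung:

* `closingCount_four_ge` — `2·4·p_4(ℤ^d) ≥ 2d(2d−2)` (the opened unit squares `(a, b, −a)`, `b ⟂ a`; in fact equality);
* `loopCompat_four_lt_one_of` — a numerical criterion: if `θ > 1`, `f(θ) ≤ 0` and `(2d−1)/θ − 1 < 2d(2d−2)/(2d−1)⁴` then
  `R_4(d) < 1` (`Δ_4 = ln((2d−1)/μ_4) ≤ (2d−1)/θ − 1`, `f_4 = 2·4·p_4/μ_2⁴ ≥ 2d(2d−2)/(2d−1)⁴`, `μ_2 = 2d − 1`);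
* **`loopCompat_four_lt_one_two` … `_six` — `R_4(d) < 1` for `d = 2, 3, 4, 5, 6`** with `θ = 2.83, 4.86, 6.89, 8.91, 10.92`
  (just below the Fisher–Sykes roots 2.8312, 4.8645, 6.8917, 8.9104, 10.9238); measured `R_4 = 0.586 / 0.715 / 0.780 / 0.820 / 0.848`.
* **`loopCompat_four_lt_one` — `R_4(d) < 1` for EVERY `d ≥ 2`**: with `x = 2d − 1`, `D = x⁴ + x² − 1` the criterion's
  threshold is `θ* = x⁵/D` and `f(θ*) = N(x)/D³` with the degree-12 polynomial `N(x) < 0` of `fsPoly_neg` (the leading terms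
  `x¹⁵, x¹⁴, x¹³` cancel — the "second-order" margin `R_4(d) = 1 − O(1/d)`), so `f < 0` slightly above `θ*`.  With
  `loopCompat_four_pos`: **`0 < R_4(d) < 1` is a THEOREM for every `d ≥ 2`** — the bond twin of
  `NawTail.siteLoopCompat_four_lt_one`; the WHOLE first rung of C4 (a), bond and site, is proved.

HONEST FRAMING: elementary numerics on top of the Fisher–Sykes identification; nothing here is used by a certified `p_c` cell.
Written by prim-pcint-2 gen 16 (prover-prim-pcint-2-g16-0), 2026-08-24.
-/

noncomputable section

open Filter Topology
open Literature.Probability.LatticeModels Literature.Probability.Percolation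
open Summit.CriticalPhenomena.PercolationContinuityZ3.Theorems.Pcint

namespace Summit.CriticalPhenomena.PercolationContinuityZ3.Theorems.Pcint.MemoryTail

variable {d : ℕ}

/-- **`2·4·p_4(ℤ^d) ≥ 2d(2d−2)`**: the opened unit squares `(a, b, −a)` with `b` off the axis of `a` are distinct closing
3-step self-avoiding words. [folklore] -/
theorem closingCount_four_ge : 2 * d * (2 * d - 2) ≤ closingCount d 4 := by
  classical
  set D := (Finset.univ : Finset (Fin d × Bool)).sigma fun a => Finset.univ.filter fun b : Fin d × Bool => b.1 ≠ a.1 with hD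
  have hDcard : D.card = 2 * d * (2 * d - 2) := by
    rw [hD, Finset.card_sigma]
    have hinner : ∀ a : Fin d × Bool, (Finset.univ.filter fun b : Fin d × Bool => b.1 ≠ a.1).card = 2 * d - 2 :=
      fun a => card_filter_fst_ne' a.1
    simp_rw [hinner, Finset.sum_const, Finset.card_univ, Fintype.card_prod, Fintype.card_fin, Fintype.card_bool, smul_eq_mul]
    ring
  rw [← hDcard]
  unfold closingCount
  let F : (Σ _ : Fin d × Bool, Fin d × Bool) → (Fin 3 → Fin d × Bool) := fun p i =>
    if i.val = 0 then p.1 else if i.val = 1 then p.2 else srev p.1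
  refine Finset.card_le_card_of_injOn F (fun p hp => ?_) (fun p hp p' hp' h => ?_)
  · rw [Finset.mem_coe, hD, Finset.mem_sigma, Finset.mem_filter] at hp
    obtain ⟨a, b⟩ := p
    have hab : b.1 ≠ a.1 := hp.2.2
    rw [Finset.mem_coe]
    show F ⟨a, b⟩ ∈ nearWords d 4 3
    have p1 : wordPos (F ⟨a, b⟩) 1 = stepVec a := by simpa [F] using wordPos_succ (F ⟨a, b⟩) (k := 0) (by omega)
    have p2 : wordPos (F ⟨a, b⟩) 2 = stepVec a + stepVec b := by
      have := wordPos_succ (F ⟨a, b⟩) (k := 1) (by omega); rw [p1] at this; simpa [F] using this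
    have p3 : wordPos (F ⟨a, b⟩) 3 = stepVec b := by
      have := wordPos_succ (F ⟨a, b⟩) (k := 2) (by omega); rw [p2] at this
      simp only [F, show ¬ (2 : ℕ) = 0 from by omega, show ¬ (2 : ℕ) = 1 from by omega, if_false, stepVec_srev] at this
      rw [this]; abel
    -- the four sites 0, e_a, e_a + e_b, e_b are distinct
    have hne0 : ∀ x : Fin d × Bool, stepVec x ≠ 0 := fun x h0 => by
      have := l1_stepVec x; rw [h0] at this; simp [l1] at this
    have hab' : stepVec a ≠ stepVec b := fun h => hab (by rw [GMStep.stepVec_injective d h])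
    have hsum : stepVec a + stepVec b ≠ 0 := fun h => by
      have : stepVec b = stepVec (srev a) := by rw [stepVec_srev]; exact eq_neg_of_add_eq_zero_right h
      exact hab (by rw [GMStep.stepVec_injective d this]; rfl)
    unfold nearWords
    rw [Finset.mem_filter, mem_sawWords]
    refine ⟨fun i j hi hj hij => ?_, by rw [p3, l1_stepVec]⟩
    interval_cases i <;> interval_cases j <;> simp only [wordPos_zero, p1, p2, p3] at hij
    all_goals first
      | rfl
      | exact absurd hij.symm (hne0 _)
      | exact absurd hij (hne0 _)
      | exact absurd hij hsum.symm
      | exact absurd hij hsum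
      | exact absurd hij hab'
      | exact absurd hij hab'.symm
      | (exfalso; exact hne0 b (by simpa using hij))
      | (exfalso; exact hne0 a (by simpa using hij))
  · obtain ⟨a, b⟩ := p
    obtain ⟨a', b'⟩ := p'
    have h0 := congrFun h ⟨0, by omega⟩
    have h1 := congrFun h ⟨1, by omega⟩
    simp only [F, if_true, show ¬ (1 : ℕ) = 0 from by omega, if_false] at h0 h1
    subst h0; subst h1; rfl

/-- **Numerical criterion for `R_4(d) < 1`**: if `θ > 1`, `f(θ) ≤ 0` (so `θ ≤ μ_4(d)`) and
`(2d−1)/θ − 1 < 2d(2d−2)/(2d−1)⁴` then `R_4(d) < 1`. [folklore] -/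
theorem loopCompat_four_lt_one_of (hd : 2 ≤ d) {θ : ℝ} (hθ : 1 < θ)
    (hf : θ ^ 3 ≤ (2 * d - 2) * θ ^ 2 + (2 * d - 2) * θ + 1)
    (hnum : (2 * (d : ℝ) - 1) / θ - 1 < 2 * d * (2 * d - 2) / (2 * d - 1) ^ 4) : loopCompat d 4 < 1 := by
  haveI : NeZero d := ⟨by omega⟩
  have hd' : (2 : ℝ) ≤ d := by exact_mod_cast hd
  have h2d1 : (0 : ℝ) < 2 * d - 1 := by linarith
  have hθ0 : 0 < θ := by linarith
  have hμθ : θ ≤ memGrowth d 4 := le_memGrowth_four_of_cubic_nonpos hd hθ hf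
  have hμ0 : 0 < memGrowth d 4 := memGrowth_pos 4
  -- the cost
  have hΔ : memLoopCost d 4 ≤ (2 * (d : ℝ) - 1) / θ - 1 := by
    unfold memLoopCost
    rw [show (4 : ℕ) - 2 = 2 from rfl, memGrowth_two_eq]
    refine (Real.log_le_sub_one_of_pos (div_pos h2d1 hμ0)).trans ?_
    have : (2 * (d : ℝ) - 1) / memGrowth d 4 ≤ (2 * (d : ℝ) - 1) / θ := by gcongr
    linarith
  -- the density
  have hf4 : 2 * (d : ℝ) * (2 * d - 2) / (2 * d - 1) ^ 4 ≤ memLoopDensity d 4 := by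
    unfold memLoopDensity
    rw [show (4 : ℕ) - 2 = 2 from rfl, memGrowth_two_eq]
    have hc : 2 * (d : ℝ) * (2 * d - 2) ≤ (closingCount d 4 : ℝ) := by
      have := closingCount_four_ge (d := d)
      have h' : ((2 * d * (2 * d - 2) : ℕ) : ℝ) ≤ (closingCount d 4 : ℝ) := by exact_mod_cast this
      rw [Nat.cast_mul, Nat.cast_mul, Nat.cast_sub (by omega)] at h'
      push_cast at h'
      linarith
    exact div_le_div_of_nonneg_right hc (pow_pos h2d1 4).le
  have hfpos : 0 < memLoopDensity d 4 :=
    lt_of_lt_of_le (div_pos (mul_pos (by positivity) (by linarith)) (pow_pos h2d1 4)) hf4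
  unfold loopCompat
  rw [div_lt_one hfpos]
  linarith

/-- **`R_4(ℤ²) < 1`** (`θ = 2.83 ≤ μ_4(2) = 2.8312`; measured `R_4(2) = 0.586`). [folklore] -/
theorem loopCompat_four_lt_one_two : loopCompat 2 4 < 1 :=
  loopCompat_four_lt_one_of (d := 2) le_rfl (θ := 2.83) (by norm_num) (by norm_num) (by norm_num)

/-- **`R_4(ℤ³) < 1`** (`θ = 4.86 ≤ μ_4(3) = 4.8645`; measured `R_4(3) = 0.715`). [folklore] -/
theorem loopCompat_four_lt_one_three : loopCompat 3 4 < 1 :=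
  loopCompat_four_lt_one_of (d := 3) (by norm_num) (θ := 4.86) (by norm_num) (by norm_num) (by norm_num)

/-- **`R_4(ℤ⁴) < 1`** (`θ = 6.89 ≤ μ_4(4) = 6.8917`; measured `R_4(4) = 0.780`). [folklore] -/
theorem loopCompat_four_lt_one_four : loopCompat 4 4 < 1 :=
  loopCompat_four_lt_one_of (d := 4) (by norm_num) (θ := 6.89) (by norm_num) (by norm_num) (by norm_num)

/-- **`R_4(ℤ⁵) < 1`** (`θ = 8.91 ≤ μ_4(5) = 8.9104`; measured `R_4(5) = 0.820`). [folklore] -/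
theorem loopCompat_four_lt_one_five : loopCompat 5 4 < 1 :=
  loopCompat_four_lt_one_of (d := 5) (by norm_num) (θ := 8.91) (by norm_num) (by norm_num) (by norm_num)

/-- **`R_4(ℤ⁶) < 1`** (`θ = 10.92 ≤ μ_4(6) = 10.9238`; measured `R_4(6) = 0.848`). [folklore] -/
theorem loopCompat_four_lt_one_six : loopCompat 6 4 < 1 :=
  loopCompat_four_lt_one_of (d := 6) (by norm_num) (θ := 10.92) (by norm_num) (by norm_num) (by norm_num)

/-! ### The general dimension -/

/-- The polynomial inequality behind the general case: with `x = 2d − 1 ≥ 3`,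
`N(x) = −2x¹² + 3x¹¹ − 3x¹⁰ − x⁹ + 2x⁸ − 2x⁷ + 4x⁶ + x⁵ − 3x² + 1 < 0`. [folklore] -/
theorem fsPoly_neg {x : ℝ} (hx : 3 ≤ x) :
    -2 * x ^ 12 + 3 * x ^ 11 - 3 * x ^ 10 - x ^ 9 + 2 * x ^ 8 - 2 * x ^ 7 + 4 * x ^ 6 + x ^ 5 - 3 * x ^ 2 + 1 < 0 := by
  have h1 : 0 < x := by linarith
  have hx1 : (1 : ℝ) ≤ x := by linarith
  have h8 : 0 < x ^ 8 := by positivity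
  have hx3 : 27 ≤ x ^ 3 := by
    have h9 : 9 ≤ x ^ 2 := by nlinarith
    have : x ^ 3 = x ^ 2 * x := by ring
    nlinarith
  have hA : -2 * x ^ 12 + 3 * x ^ 11 ≤ -3 * x ^ 11 := by
    have : x ^ 12 = x ^ 11 * x := by ring
    nlinarith [pow_pos h1 11]
  have hB : 81 * x ^ 8 ≤ 3 * x ^ 11 := by
    have : x ^ 11 = x ^ 8 * x ^ 3 := by ring
    nlinarith [mul_le_mul_of_nonneg_left hx3 h8.le]
  have hC : x ^ 6 ≤ x ^ 8 := by
    have : x ^ 8 = x ^ 6 * x ^ 2 := by ring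
    nlinarith [pow_pos h1 6, one_le_pow₀ hx1 (n := 2)]
  have hD : x ^ 5 ≤ x ^ 8 := by
    have : x ^ 8 = x ^ 5 * x ^ 3 := by ring
    nlinarith [pow_pos h1 5]
  have hE : (1 : ℝ) ≤ x ^ 8 := one_le_pow₀ hx1
  nlinarith [pow_pos h1 10, pow_pos h1 9, pow_pos h1 7, pow_pos h1 2, pow_pos h1 5, pow_pos h1 6]

/-- **`R_4(d) < 1` for EVERY `d ≥ 2`**: with `loopCompat_four_pos`, the first rung of the typed BOND window
`loopCompatWindow` is COMPLETELY a theorem, `0 < R_4(d) < 1`.  Proof: with `x = 2d−1`, `D = x⁴ + x² − 1`, the criterion's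
threshold is `θ* = x⁵/D` (`x/θ* − 1 = (x²−1)/x⁴ = f_4`'s lower bound) and `f(θ*) = N(x)/D³ < 0` (`fsPoly_neg`), so `f < 0`
slightly above `θ*` and `loopCompat_four_lt_one_of` applies. [folklore] -/
theorem loopCompat_four_lt_one (hd : 2 ≤ d) : loopCompat d 4 < 1 := by
  have hd' : (2 : ℝ) ≤ d := by exact_mod_cast hd
  set x : ℝ := 2 * d - 1 with hxdef
  have hx : 3 ≤ x := by rw [hxdef]; linarith
  have hx0 : 0 < x := by linarith
  set D : ℝ := x ^ 4 + x ^ 2 - 1 with hDdef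
  have hD0 : 0 < D := by rw [hDdef]; nlinarith [pow_pos hx0 4]
  set θs : ℝ := x ^ 5 / D with hθs
  have hθs0 : 0 < θs := div_pos (pow_pos hx0 5) hD0
  have hθs1 : 1 < θs := by
    rw [hθs, lt_div_iff₀ hD0, one_mul, hDdef]
    have h2 : 9 ≤ x ^ 2 := by nlinarith
    have h4 : 9 * x ^ 2 ≤ x ^ 4 := by
      have : x ^ 4 = x ^ 2 * x ^ 2 := by ring
      nlinarith [pow_pos hx0 2]
    have h5 : 3 * x ^ 4 ≤ x ^ 5 := by
      have : x ^ 5 = x ^ 4 * x := by ring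
      nlinarith [pow_pos hx0 4]
    nlinarith [pow_pos hx0 4]
  -- the cubic `f` with `2d − 2 = x − 1`
  set p : ℝ → ℝ := fun θ => θ ^ 3 - (x - 1) * θ ^ 2 - (x - 1) * θ - 1 with hpdef
  have hpθs : p θs < 0 := by
    have hrepr : p θs = (-2 * x ^ 12 + 3 * x ^ 11 - 3 * x ^ 10 - x ^ 9 + 2 * x ^ 8 - 2 * x ^ 7 + 4 * x ^ 6 + x ^ 5
        - 3 * x ^ 2 + 1) / D ^ 3 := by
      simp only [hpdef, hθs]
      field_simp
      rw [hDdef]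
      ring
    rw [hrepr]
    exact div_neg_of_neg_of_pos (fsPoly_neg hx) (pow_pos hD0 3)
  have hcont : Continuous p := by simp only [hpdef]; fun_prop
  obtain ⟨δ, hδpos, hball⟩ := Metric.isOpen_iff.1 (isOpen_lt hcont continuous_const) θs hpθs
  set θ : ℝ := θs + δ / 2 with hθdef
  have hmem : θ ∈ Metric.ball θs δ := by
    rw [Metric.mem_ball, Real.dist_eq, hθdef, show θs + δ / 2 - θs = δ / 2 by ring, abs_of_pos (by linarith)]
    linarith
  have hpθ : p θ < 0 := hball hmem
  have hθ1 : 1 < θ := by rw [hθdef]; linarith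
  refine loopCompat_four_lt_one_of hd hθ1 ?_ ?_
  · -- f(θ) ≤ 0 in the `d`-form
    have : (2 * (d : ℝ) - 2) = x - 1 := by rw [hxdef]; ring
    rw [this]
    simp only [hpdef] at hpθ
    linarith
  · -- x/θ − 1 < x/θ* − 1 = (x² − 1)/x⁴
    have h1 : (2 * (d : ℝ) - 1) / θ < (2 * (d : ℝ) - 1) / θs := by
      rw [← hxdef]; exact div_lt_div_of_pos_left hx0 hθs0 (by rw [hθdef]; linarith)
    have h2 : (2 * (d : ℝ) - 1) / θs - 1 = 2 * d * (2 * d - 2) / (2 * d - 1) ^ 4 := by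
      rw [← hxdef, show 2 * (d : ℝ) * (2 * d - 2) = x ^ 2 - 1 by rw [hxdef]; ring, hθs, hDdef]
      field_simp
      ring
    linarith


/-- **The `m = 2` instance of the typed conjecture `loopCompatWindow` is a theorem**: `0 < R_4(d) < 1` for every `d ≥ 2`
(`loopCompat_four_pos` of …PcintLoopExclusionFirstRungs and `loopCompat_four_lt_one`). [folklore] -/
theorem loopCompatWindow_rung_four (d : ℕ) (hd : 2 ≤ d) : 0 < loopCompat d (2 * 2) ∧ loopCompat d (2 * 2) < 1 :=
  ⟨loopCompat_four_pos hd, loopCompat_four_lt_one hd⟩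

end Summit.CriticalPhenomena.PercolationContinuityZ3.Theorems.Pcint.MemoryTail
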